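import Mathlib
import Summits.Ventures.PercRepro2.BoxUnionDefs

/-!
# The shape theorem — the four-point witnesses
(blind cell PercRepro2, mine-1 g37; part 1 of 2, paper proof proofs/MINE1-BOXUNION-SHAPE.md)

For `U ⊆ α` the *restricted covariance* is `∑_{x ∈ U} ν x (f x − E f)(g x − E g)` (the sum
`∑ x, if x ∈ U then ν x * ((f x - mean ν f) * (g x - mean ν g)) else 0`).  This file builds the
three negative witnesses used in `BoxUnionShape.lean`: the uniform weight on a 3-chain
`x < y < z` with `U ∩ {x, y, z} = {y}` (`chain_witness`, value `-1/9`), and the uniform weight on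
the 4-element Boolean sublattice `{d ⊓ d', d, d', d ⊔ d'}` of two incomparable elements with `U`
containing the square minus its top (`square_top_witness`) or minus its bottom
(`square_bot_witness`), value `-1/4`.  Each witness is an admissible weight (nonnegative,
log-supermodular — the indicator of a sublattice, `indicator_lsm` — of positive mass) with
monotone observables (`monotone_indicator_Ici`); the sums are evaluated with `sum_three` /
`sum_four`.
-/

namespace Summit.Ventures.PercRepro2

namespace BoxUnion

open Finset

open scoped Classical

noncomputable section

section LatticeOnly

variable {α : Type*} [DistribLattice α]

/-- The indicator weight of a finite sublattice (a set closed under `⊓` and `⊔`) is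
log-supermodular. -/
lemma indicator_lsm (S : Finset α) (hS : ∀ t ∈ S, ∀ u ∈ S, t ⊓ u ∈ S ∧ t ⊔ u ∈ S) (t u : α) :
    (if t ∈ S then (1 : ℝ) else 0) * (if u ∈ S then (1 : ℝ) else 0) ≤
      (if t ⊓ u ∈ S then (1 : ℝ) else 0) * (if t ⊔ u ∈ S then (1 : ℝ) else 0) := by
  by_cases ht : t ∈ S
  · by_cases hu : u ∈ S
    · simp [ht, hu, (hS t ht u hu).1, (hS t ht u hu).2]
    · simp only [hu, if_false, mul_zero]
      split_ifs <;> norm_num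
  · simp only [ht, if_false, zero_mul]
    split_ifs <;> norm_num

/-- The indicator of a principal up-set is monotone. -/
lemma monotone_indicator_Ici (c : α) : Monotone (fun t : α => if c ≤ t then (1 : ℝ) else 0) := by
  intro s t hst
  dsimp only
  by_cases hs : c ≤ s
  · rw [if_pos hs, if_pos (hs.trans hst)]
  · rw [if_neg hs]
    split_ifs <;> norm_num

/-- The four vertices of the square spanned by two incomparable elements are distinct. -/
lemma square_distinct {d d' : α} (h1 : ¬ d ≤ d') (h2 : ¬ d' ≤ d) :
    d ⊓ d' ≠ d ∧ d ⊓ d' ≠ d' ∧ d ⊓ d' ≠ d ⊔ d' ∧ d ≠ d' ∧ d ≠ d ⊔ d' ∧ d' ≠ d ⊔ d' := by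
  refine ⟨fun h => h1 (inf_eq_left.mp h), fun h => h2 (inf_eq_right.mp h), fun h => ?_,
    fun h => h1 (h ▸ le_rfl), fun h => h2 (sup_eq_left.mp h.symm), fun h => h1 (sup_eq_right.mp h.symm)⟩
  exact h1 (le_sup_left.trans (h.symm.le.trans inf_le_right))

/-- The square `{d ⊓ d', d, d', d ⊔ d'}` is a sublattice. -/
lemma square_closed (d d' : α) :
    ∀ t ∈ ({d ⊓ d', d, d', d ⊔ d'} : Finset α), ∀ u ∈ ({d ⊓ d', d, d', d ⊔ d'} : Finset α),
      t ⊓ u ∈ ({d ⊓ d', d, d', d ⊔ d'} : Finset α) ∧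
        t ⊔ u ∈ ({d ⊓ d', d, d', d ⊔ d'} : Finset α) := by
  have hmd : d ⊓ d' ≤ d := inf_le_left
  have hmd' : d ⊓ d' ≤ d' := inf_le_right
  have hds : d ≤ d ⊔ d' := le_sup_left
  have hd's : d' ≤ d ⊔ d' := le_sup_right
  have hms : d ⊓ d' ≤ d ⊔ d' := hmd.trans hds
  intro t ht u hu
  simp only [Finset.mem_insert, Finset.mem_singleton] at ht hu ⊢
  rcases ht with ht | ht | ht | ht <;> rcases hu with hu | hu | hu | hu <;> rw [ht, hu] <;>
    simp [inf_comm d' d, sup_comm d' d, hms, hmd, hmd', hds, hd's]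

end LatticeOnly

section SumsOnly

variable {α : Type*} [Fintype α]

/-- A sum over `α` of a function vanishing outside a finset `S` is the sum over `S`. -/
lemma sum_eq_sum_of_support (S : Finset α) (F : α → ℝ) (h0 : ∀ t, t ∉ S → F t = 0) :
    ∑ t, F t = ∑ t ∈ S, F t :=
  (Finset.sum_subset (Finset.subset_univ S) (fun t _ ht => h0 t ht)).symm

/-- A sum over `α` of a function supported on three distinct points. -/
lemma sum_three {x y z : α} (hxy : x ≠ y) (hxz : x ≠ z) (hyz : y ≠ z) (F : α → ℝ)
    (h0 : ∀ t, t ∉ ({x, y, z} : Finset α) → F t = 0) :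
    ∑ t, F t = F x + F y + F z := by
  rw [sum_eq_sum_of_support _ F h0, Finset.sum_insert (by simp [hxy, hxz]),
    Finset.sum_pair hyz]
  ring

/-- A sum over `α` of a function supported on four distinct points. -/
lemma sum_four {w x y z : α} (hwx : w ≠ x) (hwy : w ≠ y) (hwz : w ≠ z) (hxy : x ≠ y)
    (hxz : x ≠ z) (hyz : y ≠ z) (F : α → ℝ)
    (h0 : ∀ t, t ∉ ({w, x, y, z} : Finset α) → F t = 0) :
    ∑ t, F t = F w + F x + F y + F z := by
  rw [sum_eq_sum_of_support _ F h0, Finset.sum_insert (by simp [hwx, hwy, hwz]),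
    Finset.sum_insert (by simp [hxy, hxz]), Finset.sum_pair hyz]
  ring

end SumsOnly

section Witnesses

variable {α : Type*} [DistribLattice α] [Fintype α]

/-- **Chain witness.** If `x < y < z` with `x, z ∉ U` and `y ∈ U`, the uniform weight on
`{x, y, z}` with `f = 1_{↑z}`, `g = 1_{↑y}` is an admissible weight with monotone observables
whose restricted covariance on `U` is negative (`= -1/9`). -/
lemma chain_witness {U : Set α} {x y z : α} (hxy : x < y) (hyz : y < z)
    (hx : x ∉ U) (hy : y ∈ U) (hz : z ∉ U) :
    ∃ ν f g : α → ℝ, (∀ t, 0 ≤ ν t) ∧ (∀ t u, ν t * ν u ≤ ν (t ⊓ u) * ν (t ⊔ u)) ∧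
      0 < ∑ t, ν t ∧ Monotone f ∧ Monotone g ∧
      (∑ t, if t ∈ U then ν t * ((f t - mean ν f) * (g t - mean ν g)) else 0) < 0 := by
  set S : Finset α := {x, y, z} with hSdef
  have hxz : x < z := hxy.trans hyz
  have hS : ∀ t ∈ S, ∀ u ∈ S, t ⊓ u ∈ S ∧ t ⊔ u ∈ S := by
    simp only [hSdef, Finset.mem_insert, Finset.mem_singleton]
    rintro t (rfl | rfl | rfl) u (rfl | rfl | rfl) <;>
      simp [inf_eq_left.mpr hxy.le, sup_eq_right.mpr hxy.le, inf_eq_left.mpr hyz.le,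
        sup_eq_right.mpr hyz.le, inf_eq_left.mpr hxz.le, sup_eq_right.mpr hxz.le,
        inf_eq_right.mpr hxy.le, sup_eq_left.mpr hxy.le, inf_eq_right.mpr hyz.le,
        sup_eq_left.mpr hyz.le, inf_eq_right.mpr hxz.le, sup_eq_left.mpr hxz.le]
  refine ⟨fun t => if t ∈ S then 1 else 0, fun t => if z ≤ t then 1 else 0,
    fun t => if y ≤ t then 1 else 0, fun t => by dsimp only; split_ifs <;> norm_num,
    indicator_lsm S hS, ?_, monotone_indicator_Ici z, monotone_indicator_Ici y, ?_⟩
  · rw [sum_three hxy.ne hxz.ne hyz.ne _ (fun t ht => by simp [hSdef, ht])]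
    norm_num [hSdef]
  · have hxS : x ∈ S := by simp [hSdef]
    have hyS : y ∈ S := by simp [hSdef]
    have hzS : z ∈ S := by simp [hSdef]
    have hzx : ¬ z ≤ x := fun h => (hxz.trans_le h).false
    have hzy : ¬ z ≤ y := fun h => (hyz.trans_le h).false
    have hyx : ¬ y ≤ x := fun h => (hxy.trans_le h).false
    have hZ : ∑ t, (if t ∈ S then (1 : ℝ) else 0) = 3 := by
      rw [sum_three hxy.ne hxz.ne hyz.ne _ (fun t ht => by simp [hSdef, ht])]
      simp [hxS, hyS, hzS]
      norm_num
    have hmf : mean (fun t => if t ∈ S then (1 : ℝ) else 0) (fun t => if z ≤ t then 1 else 0)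
        = 1 / 3 := by
      unfold mean
      rw [hZ, sum_three hxy.ne hxz.ne hyz.ne _ (fun t ht => by simp [hSdef, ht])]
      simp [hxS, hyS, hzS, hzx, hzy]
    have hmg : mean (fun t => if t ∈ S then (1 : ℝ) else 0) (fun t => if y ≤ t then 1 else 0)
        = 2 / 3 := by
      unfold mean
      rw [hZ, sum_three hxy.ne hxz.ne hyz.ne _ (fun t ht => by simp [hSdef, ht])]
      simp [hxS, hyS, hzS, hyx, hyz.le]
      norm_num
    rw [hmf, hmg, sum_three hxy.ne hxz.ne hyz.ne _ (fun t ht => by simp [hSdef, ht])]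
    simp [hx, hy, hz, hyS, hzy]
    norm_num

/-- **Square witness (minus top).** If `d, d'` are incomparable, `d ⊓ d', d, d' ∈ U` and
`d ⊔ d' ∉ U`, the uniform weight on the square with `f = 1_{↑d}`, `g = 1_{↑d'}` has negative
restricted covariance on `U` (`= -1/4`). -/
lemma square_top_witness {U : Set α} {d d' : α} (h1 : ¬ d ≤ d') (h2 : ¬ d' ≤ d)
    (hm : d ⊓ d' ∈ U) (hd : d ∈ U) (hd' : d' ∈ U) (hs : d ⊔ d' ∉ U) :
    ∃ ν f g : α → ℝ, (∀ t, 0 ≤ ν t) ∧ (∀ t u, ν t * ν u ≤ ν (t ⊓ u) * ν (t ⊔ u)) ∧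
      0 < ∑ t, ν t ∧ Monotone f ∧ Monotone g ∧
      (∑ t, if t ∈ U then ν t * ((f t - mean ν f) * (g t - mean ν g)) else 0) < 0 := by
  obtain ⟨n1, n2, n3, n4, n5, n6⟩ := square_distinct h1 h2
  set S : Finset α := {d ⊓ d', d, d', d ⊔ d'} with hSdef
  refine ⟨fun t => if t ∈ S then 1 else 0, fun t => if d ≤ t then 1 else 0,
    fun t => if d' ≤ t then 1 else 0, fun t => by dsimp only; split_ifs <;> norm_num,
    indicator_lsm S (square_closed d d'), ?_, monotone_indicator_Ici d,
    monotone_indicator_Ici d', ?_⟩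
  · rw [sum_four n1 n2 n3 n4 n5 n6 _ (fun t ht => by simp [hSdef, ht])]
    norm_num [hSdef]
  · have hmS : d ⊓ d' ∈ S := by simp [hSdef]
    have hdS : d ∈ S := by simp [hSdef]
    have hd'S : d' ∈ S := by simp [hSdef]
    have hsS : d ⊔ d' ∈ S := by simp [hSdef]
    have hdm : ¬ d ≤ d ⊓ d' := fun h => h1 (h.trans inf_le_right)
    have hd'm : ¬ d' ≤ d ⊓ d' := fun h => h2 (h.trans inf_le_left)
    have hZ : ∑ t, (if t ∈ S then (1 : ℝ) else 0) = 4 := by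
      rw [sum_four n1 n2 n3 n4 n5 n6 _ (fun t ht => by simp [hSdef, ht])]
      simp [hmS, hdS, hd'S, hsS]
      norm_num
    have hmf : mean (fun t => if t ∈ S then (1 : ℝ) else 0) (fun t => if d ≤ t then 1 else 0)
        = 1 / 2 := by
      unfold mean
      rw [hZ, sum_four n1 n2 n3 n4 n5 n6 _ (fun t ht => by simp [hSdef, ht])]
      simp [hmS, hdS, hd'S, hsS, hdm, h1, le_sup_left]
      norm_num
    have hmg : mean (fun t => if t ∈ S then (1 : ℝ) else 0) (fun t => if d' ≤ t then 1 else 0)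
        = 1 / 2 := by
      unfold mean
      rw [hZ, sum_four n1 n2 n3 n4 n5 n6 _ (fun t ht => by simp [hSdef, ht])]
      simp [hmS, hdS, hd'S, hsS, hd'm, h2, le_sup_right]
      norm_num
    rw [hmf, hmg, sum_four n1 n2 n3 n4 n5 n6 _ (fun t ht => by simp [hSdef, ht])]
    simp [hm, hd, hd', hs, hmS, hdS, hd'S, hdm, hd'm, h1, h2]
    norm_num

/-- **Square witness (minus bottom).** If `d, d'` are incomparable, `d, d', d ⊔ d' ∈ U` and
`d ⊓ d' ∉ U`, the uniform weight on the square with `f = 1_{↑d}`, `g = 1_{↑d'}` has negative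
restricted covariance on `U` (`= -1/4`). -/
lemma square_bot_witness {U : Set α} {d d' : α} (h1 : ¬ d ≤ d') (h2 : ¬ d' ≤ d)
    (hm : d ⊓ d' ∉ U) (hd : d ∈ U) (hd' : d' ∈ U) (hs : d ⊔ d' ∈ U) :
    ∃ ν f g : α → ℝ, (∀ t, 0 ≤ ν t) ∧ (∀ t u, ν t * ν u ≤ ν (t ⊓ u) * ν (t ⊔ u)) ∧
      0 < ∑ t, ν t ∧ Monotone f ∧ Monotone g ∧
      (∑ t, if t ∈ U then ν t * ((f t - mean ν f) * (g t - mean ν g)) else 0) < 0 := by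
  obtain ⟨n1, n2, n3, n4, n5, n6⟩ := square_distinct h1 h2
  set S : Finset α := {d ⊓ d', d, d', d ⊔ d'} with hSdef
  refine ⟨fun t => if t ∈ S then 1 else 0, fun t => if d ≤ t then 1 else 0,
    fun t => if d' ≤ t then 1 else 0, fun t => by dsimp only; split_ifs <;> norm_num,
    indicator_lsm S (square_closed d d'), ?_, monotone_indicator_Ici d,
    monotone_indicator_Ici d', ?_⟩
  · rw [sum_four n1 n2 n3 n4 n5 n6 _ (fun t ht => by simp [hSdef, ht])]
    norm_num [hSdef]
  · have hmS : d ⊓ d' ∈ S := by simp [hSdef]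
    have hdS : d ∈ S := by simp [hSdef]
    have hd'S : d' ∈ S := by simp [hSdef]
    have hsS : d ⊔ d' ∈ S := by simp [hSdef]
    have hdm : ¬ d ≤ d ⊓ d' := fun h => h1 (h.trans inf_le_right)
    have hd'm : ¬ d' ≤ d ⊓ d' := fun h => h2 (h.trans inf_le_left)
    have hZ : ∑ t, (if t ∈ S then (1 : ℝ) else 0) = 4 := by
      rw [sum_four n1 n2 n3 n4 n5 n6 _ (fun t ht => by simp [hSdef, ht])]
      simp [hmS, hdS, hd'S, hsS]
      norm_num
    have hmf : mean (fun t => if t ∈ S then (1 : ℝ) else 0) (fun t => if d ≤ t then 1 else 0)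
        = 1 / 2 := by
      unfold mean
      rw [hZ, sum_four n1 n2 n3 n4 n5 n6 _ (fun t ht => by simp [hSdef, ht])]
      simp [hmS, hdS, hd'S, hsS, hdm, h1, le_sup_left]
      norm_num
    have hmg : mean (fun t => if t ∈ S then (1 : ℝ) else 0) (fun t => if d' ≤ t then 1 else 0)
        = 1 / 2 := by
      unfold mean
      rw [hZ, sum_four n1 n2 n3 n4 n5 n6 _ (fun t ht => by simp [hSdef, ht])]
      simp [hmS, hdS, hd'S, hsS, hd'm, h2, le_sup_right]
      norm_num
    rw [hmf, hmg, sum_four n1 n2 n3 n4 n5 n6 _ (fun t ht => by simp [hSdef, ht])]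
    simp [hm, hd, hd', hs, hdS, hd'S, hsS, h1, h2]
    norm_num

end Witnesses

end

end BoxUnion

end Summit.Ventures.PercRepro2
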